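import Literature.AlgebraicGeometry.AbelianSchemes.AbelianSchemeOverLevelBaseChange
import Literature.AlgebraicGeometry.AbelianSchemes.SymplecticLiftOfIsogenyTower
import Literature.AlgebraicGeometry.AbelianSchemes.RigidifiedLineBundleComapHom
import HarnessLib

/-!
# Pulled-back sections along a homomorphism of abelian schemes, read on the fibres

Topic `Literature/AlgebraicGeometry/AbelianSchemes`; theorems only (no definition, no named fact, no
instance). For a homomorphism `u : A → B` of abelian schemes over `S`, a section `τ ∈ A(S)` and a base
change `g : S′ → S`, Mumford's pulled-back sections ([MumfordFogartyKirwan1994] Ch. 7 §2 Def. 7.2,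
`σ ×_S S′`; tree `sectionBaseChange`) are natural in the abelian scheme:
`(τ ×_S S′) ≫ (u ×_S S′) = (τ ≫ u) ×_S S′` (functoriality of `X ↦ X ×_S S′`), and at every field-valued
point `t` of `S′` the fibre homomorphism `(u ×_S S′)_t : (A ×_S S′)_t → (B ×_S S′)_t` (★ `fibreHom` of ★
`baseChangeHom u g`, a homomorphism by ★ `isMonHom_baseChangeHom`) carries
the point `(τ ×_S S′)(t)` to `((τ ≫ u) ×_S S′)(t)` ([MumfordFogartyKirwan1994] Ch. 6 §2 Def. 6.3: values
of sections at geometric points; tree ★ `map_fibreHom_restrictPt`). For level structures related by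
`φ.σ i = (φ′.σ i)^d ≫ u` (the level-`N` structure induced on a quotient `B = A/K` from a level-`N′`
structure on `A`, `N′ = N d`) this is the pointwise reading «level structure of the fibre of the
quotient = image of the fibre's level structure» consumed by the Hecke-quotient class map.

* `sectionBaseChange_comp_baseChangeHom` — `(τ ×_S S′) ≫ (u ×_S S′) = (τ ≫ u) ×_S S′`;
* `restrictPt_sectionBaseChange_comp` — the same read at a point `t` of `S′` through `fibreHom`;
* `LevelStructure.restrictPt_baseChange_σ_of_eq_comp`,
  `LevelStructure.restrictPt_baseChange_σ_of_eq_pow_comp` — level structures with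
  `φ.σ i = φ′.σ i ≫ u`, resp. `φ.σ i = (φ′.σ i)^d ≫ u`.

## References
* [MumfordFogartyKirwan1994] D. Mumford, J. Fogarty, F. Kirwan, *Geometric Invariant Theory*, 3rd ed.,
  Ch. 6 §2 Definition 6.3 (p. 120); Ch. 7 §2 Definitions 7.1–7.2 (p. 129).
* [GortzWedhorn2020] U. Görtz, T. Wedhorn, *Algebraic Geometry I*, 2nd ed., Section (4.7)
  (pp. 107–108) (base change is a functor).
-/

noncomputable section

universe u

open CategoryTheory CategoryTheory.Limits AlgebraicGeometry MonoidalCategory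
open scoped MonObj

namespace Literature.AlgebraicGeometry.AbelianSchemes

namespace AbelianSchemeOver

open Literature.AlgebraicGeometry.Motives

variable {S S' : Scheme.{u}} {A B : AbelianSchemeOver S} (g : S' ⟶ S) (u : A.X ⟶ B.X)

/-- **Pulled-back sections are natural in the abelian scheme**: `(τ ×_S S′) ≫ (u ×_S S′) = (τ ≫ u) ×_S S′`
(the base-change functor `Over.pullback g` applied to `τ ≫ u`; `u ×_S S′` is ★ `baseChangeHom u g`). [cite: MumfordFogartyKirwan1994, Ch. 7 §2
Definition 7.2 (p. 129)] [cite: GortzWedhorn2020, Section (4.7) (pp. 107–108)] -/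
theorem sectionBaseChange_comp_baseChangeHom (τ : A.Sections) :
    A.sectionBaseChange g τ ≫ baseChangeHom u g = B.sectionBaseChange g (τ ≫ u) := by
  rw [sectionBaseChange_apply, sectionBaseChange_apply, Functor.map_comp]
  exact Category.assoc _ _ _

variable [IsMonHom u] {Ω : Type u} [Field Ω] (t : Spec (.of Ω) ⟶ S')

/-- **The fibre homomorphism `(u ×_S S′)_t` carries `(τ ×_S S′)(t)` to `((τ ≫ u) ×_S S′)(t)`** — ★
`map_fibreHom_restrictPt` for the base-changed homomorphism `u ×_S S′ = baseChangeHom u g` (a homomorphism of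
`S′`-group schemes, ★ `isMonHom_baseChangeHom`) and the naturality of pulled-back sections. [cite: MumfordFogartyKirwan1994, Ch. 6 §2 Definition 6.3 (p. 120) and Ch. 7 §2 Definition 7.2
(p. 129)] -/
theorem restrictPt_sectionBaseChange_comp (τ : A.Sections) :
    haveI := isMonHom_baseChangeHom u g
    (B.baseChange g).restrictPt t (B.sectionBaseChange g (τ ≫ u)) =
      AlgPoints.map (fibreHom (baseChangeHom u g) t).hom.hom.hom
        ((A.baseChange g).restrictPt t (A.sectionBaseChange g τ)) := by
  haveI := isMonHom_baseChangeHom u g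
  rw [map_fibreHom_restrictPt t (baseChangeHom u g), sectionBaseChange_comp_baseChangeHom]

/-- **Level structures related through `u`, read on the fibres of a base change**: if `φ.σ i = φ′.σ i ≫ u`
for all `i`, then at every point `t` of `S′` the point `(φ ×_S S′)ᵢ(t)` of `(B ×_S S′)_t` is the image of
`(φ′ ×_S S′)ᵢ(t)` under `(u ×_S S′)_t`. [cite: MumfordFogartyKirwan1994, Ch. 7 §2 Definitions 7.1–7.2
(p. 129)] -/
theorem LevelStructure.restrictPt_baseChange_σ_of_eq_comp {g₀ n n' : ℕ} (φ' : A.LevelStructure g₀ n')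
    (φ : B.LevelStructure g₀ n) (hσ : ∀ i, φ.σ i = φ'.σ i ≫ u) (i : Fin g₀ ⊕ Fin g₀) :
    haveI := isMonHom_baseChangeHom u g
    (B.baseChange g).restrictPt t ((φ.baseChange g).σ i) =
      AlgPoints.map (fibreHom (baseChangeHom u g) t).hom.hom.hom
        ((A.baseChange g).restrictPt t ((φ'.baseChange g).σ i)) := by
  rw [LevelStructure.baseChange_σ, LevelStructure.baseChange_σ, hσ i]
  exact restrictPt_sectionBaseChange_comp g u t (φ'.σ i)

/-- **The quotient reading**: if `φ.σ i = (φ′.σ i)^d ≫ u` for all `i` (the level-`n` structure a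
level-`n′ = n d` structure induces through a homomorphism `u`), then at every point `t` of `S′`,
`(φ ×_S S′)ᵢ(t) = (u ×_S S′)_t ((φ′ ×_S S′)ᵢ(t)^d)` — pulled-back sections form a monoid homomorphism
(`sectionBaseChange`, `map_pow`). [cite: MumfordFogartyKirwan1994, Ch. 7 §2 Definitions 7.1–7.2 (p. 129)
and App. 7A (p. 235)] -/
theorem LevelStructure.restrictPt_baseChange_σ_of_eq_pow_comp {g₀ n n' d : ℕ}
    (φ' : A.LevelStructure g₀ n') (φ : B.LevelStructure g₀ n) (hlev : ∀ i, φ.σ i = (φ'.σ i ^ d) ≫ u)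
    (i : Fin g₀ ⊕ Fin g₀) :
    haveI := isMonHom_baseChangeHom u g
    (B.baseChange g).restrictPt t ((φ.baseChange g).σ i) =
      AlgPoints.map (fibreHom (baseChangeHom u g) t).hom.hom.hom
        ((A.baseChange g).restrictPt t ((φ'.baseChange g).σ i ^ d)) := by
  rw [LevelStructure.baseChange_σ, LevelStructure.baseChange_σ, hlev i, ← map_pow]
  exact restrictPt_sectionBaseChange_comp g u t (φ'.σ i ^ d)

end AbelianSchemeOver

end Literature.AlgebraicGeometry.AbelianSchemes
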